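import Literature.NumberTheory.Automorphic.DerivWeightAdUnipotent
import Literature.NumberTheory.Automorphic.MixedSpaceMomentKernelsFourier
import Mathlib.Analysis.Calculus.LineDeriv.IntegrationByParts
import HarnessLib

/-!
# Absorption of unipotent derivatives by the convolution kernel (integration by parts on `K_∞`)

Topic `NumberTheory/Automorphic`; namespace `Literature.NumberTheory.Automorphic`. Proof file
(theorems only). For a test function `θ` on `GL_2(𝔸_K)`, a `C^∞` compactly supported real kernel
`g` on `K_∞` and `c ∈ K_∞`, the derivative of `θ` along the unipotent direction `c E₁₂ ∈ 𝔤` is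
absorbed by the archimedean unipotent convolution:

  `g ⋆ θ_{c E₁₂} = -(∂_c g) ⋆ θ`,   `(∂_c g)(x) = Dg(x)(c)`

(`archUnipotentConv_derivWeight_smul_matE`; the point being that `θ_{cE₁₂}(n(x)⁻¹ h)` is the
derivative in `x`, direction `c`, of `x ↦ θ(n(x)⁻¹ h)` — `derivWeight_smul_matE_apply_eq_fderiv` — and
integration by parts on the real vector space `K_∞`, Mathlib
`integral_mul_fderiv_eq_neg_fderiv_mul_of_integrable`). Also: the derivative kernel `∂_c g` is
again `C^∞` with compact support (`contDiff_fderiv_dir`, `hasCompactSupport_fderiv_dir`).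
This is the mechanism by which the unipotent letters of a Sobolev word cost no power of the torus
variable in the Kirillov `L²`-bound (Jacquet–Shalika (1981), §4).

## References

* H. Jacquet, J. A. Shalika, *On Euler products and the classification of automorphic
  representations I*, Amer. J. Math. 103 (1981), §4 [JacquetShalikaAJM1981].
* D. Bump, *Automorphic Forms and Representations* (1997), §2.2, (2.28)–(2.29) [Bump1997].
-/

noncomputable section

open scoped MatrixGroups Classical ContDiff
open NumberField NumberField.mixedEmbedding IsDedekindDomain MeasureTheory

namespace Literature.NumberTheory.Automorphic

variable {K : Type} [Field K] [NumberField K]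
  (hcpt : isCompact_glFiniteIntegralLevel 2 K)

set_option backward.isDefEq.respectTransparency false

attribute [local instance 100] LieRing.ofAssociativeRing

-- `M_2(K_∞)` is finite-dimensional over `ℝ`: the tree's named shortcut instance
-- `finiteDimensional_matrix_mixedSpace` (of `GLnCuspidalSpectrumSiegelProofs`), activated locally.
attribute [local instance] finiteDimensional_matrix_mixedSpace

open scoped Matrix.Norms.Operator

/-! ### The derivative kernel -/

/-! ### The unipotent derivative as a derivative in the unipotent variable -/

/-- The slice at a unipotent right? translate: `leftArchSlice θ (n(x)⁻¹ h) (m) = leftArchSlice θ h (m n(-x))`.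
[folklore] -/
theorem leftArchSlice_archUnipotent_inv_mul (θ : GL (Fin 2) (AdeleRing (𝓞 K) K) → ℝ) (x : mixedSpace K)
    (h : GL (Fin 2) (AdeleRing (𝓞 K) K)) (m : Matrix (Fin 2) (Fin 2) (mixedSpace K)) :
    leftArchSlice θ ((archUnipotentGL K x)⁻¹ * h) m = leftArchSlice θ h (m * unipotentMatrixGL2 (-x)) := by
  by_cases hm : IsUnit m
  · obtain ⟨u, rfl⟩ := hm
    have hu : (u : Matrix (Fin 2) (Fin 2) (mixedSpace K)) * unipotentMatrixGL2 (-x) =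
        ((u * ((unipotentGL2 (-x) : ↥(upperUnitriangular (Fin 2) (mixedSpace K))) : GL (Fin 2) (mixedSpace K)) :
          GL (Fin 2) (mixedSpace K)) : Matrix (Fin 2) (Fin 2) (mixedSpace K)) := by
      rw [Units.val_mul]
    rw [hu, leftArchSlice_coe, leftArchSlice_coe, map_mul, ← archUnipotentGL_eq, archUnipotentGL_neg, mul_assoc]
  · have hm' : ¬IsUnit (m * unipotentMatrixGL2 (-x)) := by
      intro hu
      apply hm
      have : m = m * unipotentMatrixGL2 (-x) * unipotentMatrixGL2 x := by
        rw [mul_assoc, unipotentMatrixGL2, unipotentMatrixGL2, ← Units.val_mul, ← Subgroup.coe_mul,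
          ← unipotentGL2_add, neg_add_cancel, unipotentGL2_zero, Subgroup.coe_one, Units.val_one, mul_one]
      rw [this]
      exact hu.mul (Units.isUnit _)
    rw [leftArchSlice_of_not_isUnit hm, leftArchSlice_of_not_isUnit hm']

/-- The unipotent orbit function `Θ_h(z) = θ(n(z)⁻¹ h) = leftArchSlice θ h (n(-z))`. [folklore] -/
theorem theta_archUnipotent_inv_mul_eq (θ : GL (Fin 2) (AdeleRing (𝓞 K) K) → ℝ) (z : mixedSpace K)
    (h : GL (Fin 2) (AdeleRing (𝓞 K) K)) :
    θ ((archUnipotentGL K z)⁻¹ * h) = leftArchSlice θ h (unipotentMatrixGL2 (-z)) := by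
  rw [← archUnipotentGL_neg, archUnipotentGL_eq, ← leftArchSlice_coe (η := θ) (x := h)]

/-- The unipotent orbit function is smooth in `z`. [folklore] -/
theorem contDiff_theta_archUnipotent {θ : GL (Fin 2) (AdeleRing (𝓞 K) K) → ℝ} (hθ : IsTestFunctionGL 2 K θ)
    (h : GL (Fin 2) (AdeleRing (𝓞 K) K)) :
    ContDiff ℝ ∞ fun z : mixedSpace K => θ ((archUnipotentGL K z)⁻¹ * h) := by
  simp_rw [theta_archUnipotent_inv_mul_eq]
  exact (hθ.contDiff_leftArchSlice h).comp (contDiff_coe_unipotentGL2.comp contDiff_neg)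

/-- **The unipotent derivative is a derivative in the unipotent variable**:
`θ_{c E₁₂}(n(x)⁻¹ h) = D_x (x ↦ θ(n(x)⁻¹ h)) (c)`. [folklore] -/
theorem derivWeight_smul_matE_apply_eq_fderiv {θ : GL (Fin 2) (AdeleRing (𝓞 K) K) → ℝ} (hθ : IsTestFunctionGL 2 K θ)
    (c x : mixedSpace K) (h : GL (Fin 2) (AdeleRing (𝓞 K) K)) :
    derivWeight (AutomorphyDatum.gl 2 K hcpt).ofArch (toLie hcpt (c • (matE : Matrix (Fin 2) (Fin 2) (mixedSpace K)))) θ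
        ((archUnipotentGL K x)⁻¹ * h) =
      fderiv ℝ (fun z : mixedSpace K => θ ((archUnipotentGL K z)⁻¹ * h)) x c := by
  rw [derivWeight_eq_fderiv_leftArchSlice hcpt hθ]
  -- left-hand side: chain rule through `m ↦ m n(-x)`
  have hsl : leftArchSlice θ ((archUnipotentGL K x)⁻¹ * h) =
      leftArchSlice θ h ∘ fun m => m * unipotentMatrixGL2 (-x) := by
    funext m; exact leftArchSlice_archUnipotent_inv_mul θ x h m
  have hR : HasFDerivAt (fun m : Matrix (Fin 2) (Fin 2) (mixedSpace K) => m * unipotentMatrixGL2 (-x))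
      ((ContinuousLinearMap.mul ℝ (Matrix (Fin 2) (Fin 2) (mixedSpace K))).flip (unipotentMatrixGL2 (-x))) 1 := by
    have := ((ContinuousLinearMap.mul ℝ (Matrix (Fin 2) (Fin 2) (mixedSpace K))).flip (unipotentMatrixGL2 (-x))).hasFDerivAt
      (x := (1 : Matrix (Fin 2) (Fin 2) (mixedSpace K)))
    exact this
  have hdiff := ((hθ.contDiff_leftArchSlice h).differentiable (by simp))
  rw [hsl, ((hdiff _).hasFDerivAt.comp 1 hR).fderiv]
  -- right-hand side: chain rule through `z ↦ n(-z)`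
  have hΘ : (fun z : mixedSpace K => θ ((archUnipotentGL K z)⁻¹ * h)) =
      leftArchSlice θ h ∘ fun z => unipotentMatrixGL2 (-z) := by
    funext z; exact theta_archUnipotent_inv_mul_eq θ z h
  set L : mixedSpace K →L[ℝ] Matrix (Fin 2) (Fin 2) (mixedSpace K) :=
    ⟨unipotentDirGL2, LinearMap.continuous_of_finiteDimensional _⟩ with hL
  have hN : HasFDerivAt (fun z : mixedSpace K => unipotentMatrixGL2 (-z)) (-L) x := by
    have h1 : (fun z : mixedSpace K => unipotentMatrixGL2 (-z)) = fun z => 1 + (-L) z := by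
      funext z
      rw [show (-L) z = L (-z) from by simp [map_neg]]
      exact coe_unipotentGL2_eq_one_add (-z)
    rw [h1]
    exact ((-L).hasFDerivAt).const_add 1
  rw [hΘ, ((hdiff _).hasFDerivAt.comp x hN).fderiv]
  simp only [ContinuousLinearMap.coe_comp, Function.comp_apply, ContinuousLinearMap.flip_apply,
    ContinuousLinearMap.mul_apply', one_mul]
  congr 1
  -- `-(c E) n(-x) = -(c E)` since `E² = 0`, and `-L c = -(unipotentDirGL2 c) = -(c E)`
  have hLc : (-L) c = -(unipotentDirGL2 c) := by simp [hL]
  rw [hLc, ← smul_matE, unipotentMatrixGL2_eq, neg_mul, mul_add, mul_one, mul_smul_comm, smul_mul_assoc, matE_mul_matE,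
    smul_zero, smul_zero, add_zero]

/-! ### Absorption -/

/-- **Absorption of a unipotent derivative by the kernel**: `g ⋆ θ_{cE₁₂} = -(∂_c g) ⋆ θ` for a test
function `θ` and a `C^∞` compactly supported kernel `g` (integration by parts on `K_∞`).
[cite: JacquetShalikaAJM1981, §4] -/
theorem archUnipotentConv_derivWeight_smul_matE {θ : GL (Fin 2) (AdeleRing (𝓞 K) K) → ℝ} (hθ : IsTestFunctionGL 2 K θ)
    {g : mixedSpace K → ℝ} (hg : ContDiff ℝ ∞ g) (hgs : HasCompactSupport g) (c : mixedSpace K) :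
    archUnipotentConv g
        (derivWeight (AutomorphyDatum.gl 2 K hcpt).ofArch (toLie hcpt (c • (matE : Matrix (Fin 2) (Fin 2) (mixedSpace K)))) θ) =
      -archUnipotentConv (fun x => fderiv ℝ g x c) θ := by
  refine funext fun (h : GL (Fin 2) (AdeleRing (𝓞 K) K)) => ?_
  rw [Pi.neg_apply, archUnipotentConv_apply_gl, archUnipotentConv_apply_gl]
  have hΘs : ContDiff ℝ ∞ fun z : mixedSpace K => θ ((archUnipotentGL K z)⁻¹ * h) := contDiff_theta_archUnipotent hθ h
  have hpt : ∀ x, g x * derivWeight (AutomorphyDatum.gl 2 K hcpt).ofArch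
      (toLie hcpt (c • (matE : Matrix (Fin 2) (Fin 2) (mixedSpace K)))) θ ((archUnipotentGL K x)⁻¹ * h) =
      g x * fderiv ℝ (fun z : mixedSpace K => θ ((archUnipotentGL K z)⁻¹ * h)) x c := fun x => by
    rw [derivWeight_smul_matE_apply_eq_fderiv hcpt hθ c x h]
  rw [integral_congr_ae (ae_of_all _ hpt)]
  -- integration by parts on `K_∞`
  have hgc : Continuous g := hg.continuous
  have hΘc : Continuous fun z : mixedSpace K => θ ((archUnipotentGL K z)⁻¹ * h) := hΘs.continuous
  have hg'c : Continuous fun x => fderiv ℝ g x c := (contDiff_fderiv_dir (K := K) hg c).continuous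
  have hΘ'c : Continuous fun x => fderiv ℝ (fun z : mixedSpace K => θ ((archUnipotentGL K z)⁻¹ * h)) x c :=
    (contDiff_fderiv_dir (K := K) hΘs c).continuous
  have h1 : Integrable (fun x => fderiv ℝ g x c * θ ((archUnipotentGL K x)⁻¹ * h)) :=
    (hg'c.mul hΘc).integrable_of_hasCompactSupport (hasCompactSupport_fderiv_dir (K := K) hgs c).mul_right
  have h2 : Integrable (fun x => g x * fderiv ℝ (fun z : mixedSpace K => θ ((archUnipotentGL K z)⁻¹ * h)) x c) :=
    (hgc.mul hΘ'c).integrable_of_hasCompactSupport hgs.mul_right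
  have h3 : Integrable (fun x => g x * θ ((archUnipotentGL K x)⁻¹ * h)) :=
    (hgc.mul hΘc).integrable_of_hasCompactSupport hgs.mul_right
  exact integral_mul_fderiv_eq_neg_fderiv_mul_of_integrable h1 h2 h3
    (fun x _ => (hg.differentiable (by simp)) x) (fun x _ => (hΘs.differentiable (by simp)) x)

end Literature.NumberTheory.Automorphic
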